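import Mathlib
import HarnessLib
import HarnessLib.Audit
import Summits.AtomisticToContinuum.Statement

/-!
Route: EinsteinBath

CLOSED (retired) 2026-08-15T13:41:57Z by operator:999:1257524 — reason: not-a-thesis: assembly does not conclude the sub-problem Statement — note: D-0027 §2.1 audit (human 2026-08-15: routes that do not decide the summit are removed): the assembly concludes `Literature.MathematicalPhysics.KineticTheory.HydrodynamicLimit`, not the sub-problem statement; a NEW conforming route may be opened from the same idea (generated `closes : … → _root_.Hydr. The file is kept as the record of this route; refuted decls are indexed as negative knowledge (`ledger negatives`).

# Route EinsteinBath — Einstein's bath run backwards — a negligible ideal gas of light points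
manufactures OVY's weak noise mechanically; Euler for the deterministic two-species gas, then remove
the solvent

X = X_E ∧ X_R ("it suffices to show"; realises card einstein-bath-vanishing-solvent). Couple the
conjunct's N+1 hard spheres
(mass 1, diameter ε_N = σ(N+1)^(-1/3)) to an IDEAL gas of K_N = ⌊(N+1)^(1-a)⌋ POINT particles of
mass m_N = (N+1)^(-b) that fly freely,
never see each other and bounce elastically (mass-(1,m) specular law) off the spheres — a
deterministic, reversible, Liouville-preserving
two-species hard-body flow Ψ_N on 𝕋³; lights start uniform outside the spheres, Maxwellian (mass
m_N) at the local temperature θ₀(x)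
and drift u₀(x), so the sphere marginal of the joint law is EXACTLY the local Gibbs law (points
cause no depletion). WINDOW:
0 < a < 1/3, 0 < b < 2/3 − 2a: bath fraction K/N = N^(-a) → 0 (thermodynamically and
hydrodynamically invisible), kick size
√(mθ) = N^(-b/2) → 0 (diffusion approximation), velocity-randomisation rate per sphere γ_N ≍ K ε² √m
≍ N^(1/3−a−b/2) → ∞ per
macroscopic time while γ_N/N^(1/3) → 0 per collision — exactly the Olla–Varadhan–Yau weak-noise
regime θ(ε) → ∞, εθ(ε) → 0.
X_E (EinsteinBathEuler): for every (a,b) in the window the SPHERE fields of the deterministic joint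
system converge in probability to
the classical hs-Euler solution before the first shock (hypotheses exactly as in the conjunct). X_R
(BathRemoval): for the same data,
convergence in probability of the sphere fields at time t under the joint dynamics implies it under
the bare hard-sphere flow
(removal of a thermodynamically negligible solvent). X_E ∧ X_R ∧ (existence of the two-species flow)
→ HydrodynamicLimit is pure logic
(proved sorry-free in Sketch.lean).
Lean: `EinsteinBathEuler ∧ BathRemoval`

## Assembly
Pure logic, proved sorry-free in Sketch.lean (`assembly_holds`, axioms
propext/Classical.choice/Quot.sound): fix profiles; EinsteinBathEuler
with (a,b) = (1/6,1/6) gives σ₀; take min(σ₀, 1/2); for σ below it, a classical Euler solution,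
flows Φ_N and the time-0 hypothesis, pick
Ψ_N from MixedFlowExists (ε = hsDiameter σ N ∈ (0, 1/2) by hsDiameter_pos/hsDiameter_le, m_N > 0 by
rpow_pos), get joint convergence at
t from EinsteinBathEuler and bare convergence from BathRemoval; this is HydrodynamicLimit verbatim.

Rationale: WHY THIS LINE. Olla–Varadhan–Yau (OllaVaradhanYau1993 Thm 1.1; Varadhan's CIME lectures,
lit:arkeryd1993 p.117) need their conservative velocity noise
for ONE purpose — the ergodic step (LiveraniOlla1996, FritzFunakiLebowitz1994: Hamiltonian +
velocity noise ⇒ finite-entropy stationary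
states are Gibbs) — and its strength is o(collision rate). The mechanical theory of Brownian motion
(DurrGoldsteinLebowitz1981 =
Spohn1991 Thm 8.3; DurrGoldsteinLebowitz1983; CalderoniDurrKusuoka1989; several bodies with
gas-mediated coupling KusuokaLiang2010,
Liang2018; kinetic twin DegondLucquinDesreux1996; deterministic averaging for a massive body
ChernovLebowitzSinai2002) rests on an EXACT
structural fact: conditionally on the heavy paths the ideal-gas atoms are independent, so the bath's
action is a law of large numbers,
not a chaos hypothesis. Imported area: stochastic-process limit theorems for mechanical Brownian
motion (probability) feeding the
relative-entropy method (hydrodynamic limits); physical dictionary [OVY noise θ(ε)] ↦ [Epstein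
friction/kicks of the light gas, rate γ_N],
[εθ(ε) → 0] ↦ [b < 2/3 − 2a]. What it does that prior routes do not: VanishingNoise POSTULATES the
noise and sends it to zero;
here the noise is DERIVED from Hamiltonian mechanics, the fixed-window rung X_E is a DETERMINISTIC
positive-density Euler theorem
(outside the Boltzmann-hypothesis barrier's reach once BathReduction holds), and the return to the
conjunct is the comparison of
two deterministic Hamiltonian systems (solvent removal) with a second small parameter K/N.
CanestrariLiveraniOlla2026 (heat equation
from deterministic dynamics via fast chaotic forcing) is the nearest "deterministic noise"
precedent; it uses hyperbolicity, not an
ideal bath, and is diffusive, not Euler. Negatives index: empty at filing.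

RANKED CRUXES. #2 EinsteinBathEuler (crux) — (card cruxes 1+2, rung R1 in the OVY window) for all 0
< a < 1/3, 0 < b < 2/3 − 2a, all continuous profiles a₀, θ₀ > 0, u₀: ∃ σ₀ ∀ σ ∈ (0,σ₀) ∀ classical
hs-Euler solutions on [0,T) ∀ hard-sphere flows Φ_N ∀ two-species flows Ψ_N (N+1 spheres of diameter
hsDiameter σ N, K_N = ⌊(N+1)^(1−a)⌋ points of mass (N+1)^(−b); Ψ_N measurable, Lebesgue-preserving
on the mixed hard-body domain, a.e. orbit a mixed hard-body trajectory: free flight, elastic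
sphere–sphere collisions, mass-(1,m) specular sphere–point collisions; all such Ψ agree a.e.): if
the local Gibbs fields converge at t = 0, then for every t < T the empirical density/momentum/energy
fields of the SPHERE component of Ψ_N(t) converge in probability, under the joint law localGibbs ⊗
(K_N i.i.d. lights uniform outside the exclusion balls × Maxwellian of mass m_N at θ₀(x), drift
u₀(x)), to (ρ, ρu, E)(t). Layer-2 content: BathReduction (rank 3, informal) + OVY's theorem for hard
spheres driven by the bath's exchange kernel. [deps: MixedFlowExists, BathMarginalExact]
[difficulty: open-problem] (why it might fail: OVY kept noise θ(ε)→∞ yet still had to modify the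
kinetic energy (cubic velocity term, arkeryd1993 p.116): bath friction need not cure it; and
BathReduction uniform in N (shadowing between spheres at distance O(ε)) is unproved.)
[OllaVaradhanYau1993, lit:arkeryd1993 p.116-117, DurrGoldsteinLebowitz1981, KusuokaLiang2010,
LiveraniOlla1996, FritzFunakiLebowitz1994]
#4 BathRemoval (crux) — (card crux 3, rungs R2–R3: removal of a vanishing solvent) for all (a,b) in
the window, σ ∈ (0,1), continuous profiles, hard-sphere flows Φ_N, two-species flows Ψ_N as above,
all target fields (ρ,u,θ)(t,·) and times t: if the sphere fields of Ψ_N(t) converge in probability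
under the joint law to (∫χρ_t, ∫χρ_t u_t, ∫χE_t) for all continuous χ, then TendstoHydroFieldsAt
(localGibbsLaw) Φ ρ u θ t — the bare deterministic hard-sphere fields converge to the same targets.
Physically: a solvent with energy/momentum/pressure content O(N^(−a)), transport O(N^(−2a)) and
per-collision randomisation O(N^(−a−b/2)) does not change the Euler-scale fields of the solute.
[deps: EinsteinBathEuler] [difficulty: open-problem] (why it might fail: given EinsteinBathEuler it
is equivalent to the conjunct: Lyapunov rate ≍ N^(1/3) defeats any pathwise coupling, and no
law-level stability of macroscopic fields under o(1)-per-collision perturbations is known (same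
status as VanishingNoise 0812).) [OllaVaradhanYau1993, Spohn1991, lit:arkeryd1993 p.117,
KusuokaLiang2010]
#9 MixedFlowExists (support) — CONSTRUCTION item for the posited object (never smuggled into the
cruxes): for all n, k, 0 < ε < 1/2, m > 0 there is a two-species hard-body flow Ψ on 𝕋³ (n spheres
of diameter ε and mass 1, k points of mass m; measurable, Lebesgue-preserving on the mixed domain,
identity at time 0 a.e., a.e. orbit a mixed trajectory; the group law follows from a.e. uniqueness)
— Alexander's theorem for a binary hard-ball mixture with radii (ε/2, 0) (locally finitely many
collisions a.e. by energy bounds; points never meet). [difficulty: L] [Alexander1975 (via Literature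
HardSphereDynamics.lean), GallagherSaintRaymondTexier2013 Prop. 4.1.1, Spohn1991 Thm 8.3]
#9 BathMarginalExact (support) — the bath is statically invisible: for σ ∈ (0,1), continuous
profiles (a₀, θ₀ > 0, u₀), every N, k, m > 0 and flow Φ, the sphere marginal (push-forward under
Prod.fst) of the joint law localGibbsLaw ⊗ [k i.i.d. lights with density (1 − πσ³/6)⁻¹·𝟙(outside all
balls B(q_i, ε/2))·Maxwellian_m(θ₀(x), u₀(x))] IS localGibbsLaw σ a₀ u₀ θ₀ N Φ — the exclusion balls
of radius ε/2 around centres at mutual distance ≥ ε are disjoint, so the excluded volume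
(N+1)(π/6)ε³ = πσ³/6 is configuration-independent (no depletion interaction). [difficulty:
provable-now] [Spohn1991 Part I Ch. 3, Literature HardSphereEuler.lean
(succ_mul_hsDiameter_pow_three)]

TWO-LAYER PLAN. EinsteinBathEuler ⇐ BathReduction → NoisyOVYBathKernel → EinsteinBathEuler (k = 2):
BathReduction (filed now as the informal rank-3
crux; typed once the definition requests land) says the sphere component of Ψ_N is o(1)-close in law
of field statistics to
S_N(γ_N) = hard-sphere flow + conservative OU exchange noise with the explicit Epstein/ping-pong
kernel; NoisyOVYBathKernel is
OllaVaradhanYau1993 Thm 1.1 for hard spheres with that kernel in the window (shares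
LargeVelocityControl with RelEntropyErgodic 0781 and
the base case with VanishingNoise 0813). BathRemoval ⇐ (sub-OVY window b ≥ 2/3 − 2a, γ_N → 0:
VanishingNoise 0811-type uniform entropy
bound) → (removal at γ_N ≤ N^(−k)) → BathRemoval, only if a stability handle appears. Nothing here
is filed now.

KILL CRITERIA. Close `refuted:EinsteinBathEuler` if the bath provably fails to reduce uniformly in N
anywhere in the window (e.g. shadowing/depletion of
lights between spheres at distance O(ε) makes the exchange kernel degenerate so that Liverani–Olla
ergodicity fails, or the two-species
Euler system differs from hs-Euler at order 1 for some admissible (a,b)) — the typed statement is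
∀(a,b), so one bad corner kills it
as stated and forces a pivot to a restated window. BathRemoval can only die with the conjunct (given
X_E it is equivalent to it);
if VanishingNoise 0812 is refuted in a form covering Hamiltonian baths, close this route too.
RelEntropyVanishing (0766) or the
conjunct proved elsewhere moots the route; X_E would survive as a theorem about a deterministic
two-species gas.

NOT DECOMPOSED YET. The reduced generator S_N(γ) and its kernel (definition request), the OU/Povzner
large-velocity estimate inside the entropy method,
block sizes and the one/two-block lemmas for the bath kernel, the choice of (a,b) for removal, and
any quantitative (rate) version of
X_E — all layer-2 children after BathReduction is typed or X_E moves.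

CHEAPEST FALSIFIER. (i) Two-sphere kernel computation (paper-and-pencil / kit): the m → 0 limit of
the bath-mediated momentum–energy exchange between two
spheres at distance r ∈ (ε, λ_L) (ping-pong series, view factors with shadowing) must be a smooth,
hypoelliptic, Gibbs-reversible
exchange kernel; if it only exchanges the radial momentum component, Liverani–Olla needs the
collisions' help and X_E's layer 2
weakens. (ii) Event-driven MD (points vs spheres is a trivial extension): φ = 0.05, N = 10⁴, a = b =
1/6: check sphere VACF damping
≈ predicted Epstein γ_N, bath energy fraction ≈ N^(−1/6), and that a sound pulse in the spheres
travels at the PURE hard-sphere sound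
speed; failure of the last kills the window bookkeeping. Not run here (kit not requested in plancard
mode).

NUMBERS. Window exponents: bath fraction N^(−a); kick √(m_Nθ) = N^(−b/2); light speed N^(b/2); light
mean free path 4/(πσ²)·N^(−1/3);
γ_N ≍ N^(1/3−a−b/2) (OVY: → ∞), per-collision fraction N^(−a−b/2) → 0; bath heat flux / sphere
energy flux ≲ N^(−2a); bath viscosity
relative N^(−1/3−a−b/2). Epstein specular drag on a sphere of radius R in an ideal gas (n, m, θ): γM
= (8/3)√(2πmθ) n R²
(Spohn1991 (8.62) for d = 3). OVY: θ(ε) → ∞, εθ(ε) → 0 (arkeryd1993 p.117). Items at open: 6 (+1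
informal crux filed after open).

DEFINITION REQUESTS. (1) PolydisperseHardSphereFlow (Literature/Analysis/FluidPDE): HardSphereFlow
with per-species mass and diameter (additive contact
distances), Alexander existence on 𝕋³ — would replace the 2.3 kB inline predicate `IsMF` in the
three typed items. (2) BathExchangeDynamics
(Summits/AtomisticToContinuum/HydrodynamicLimit/Theorems): hard-sphere flow + conservative OU
velocity-exchange noise with a given smooth
kernel (shared need with VanishingNoise's noisy dynamics), to type BathReduction. Cite facts wanted:
DurrGoldsteinLebowitz1981 main theorem
(= Spohn1991 Thm 8.3), KusuokaLiang2010 main theorem (acq-02302 pending).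

Novelty: Searches (2026-08-15): `lit search --hybrid "Olla Varadhan Yau hydrodynamical limit Hamiltonian weak
noise"` (12; Varadhan CIME notes
read, arkeryd1993 pp.114-117); `lit search --hybrid "heavy particle ideal gas Ornstein-Uhlenbeck
mass ratio"` (12; Spohn1991 §8.2-8.4 read,
Thm 8.3); `lit search --source s2 "Kusuoka Liang classical mechanical model Brownian motion plural
particles"` (6: KusuokaLiang2010,
Liang 2012/2014/2018/2021 variants, all finitely many bodies); `lit search --source zbmath` same (1,
summary read); `lit frontier
AtomisticToContinuum --since 2020` (30; nearest: CanestrariLiveraniOlla2026 arXiv:2310.13338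
deterministic heat equation via chaotic
forcing; arXiv:2605.19694/19696 Rayleigh-gas mixtures at Boltzmann–Grad — different object); `lit
bridges AtomisticToContinuum --cross any`
(30; none couples an ideal bath to a dense sphere fluid); `lit galaxy search "mechanical model of
Brownian motion" --star all` and
`"Brownian motion in an ideal gas" --star all` (galaxyd queue timeout twice, 0 rows — recorded, not
retried further); the card's own
crossref searches (DGL, CDK, Kusuoka–Liang, CLS) and the refuter audit's added prior
(Degond–Lucquin-Desreux, Kotelenez, Szász–Tóth).
Nearest prior art found: DurrGoldsteinLebowitz1981 / Spohn1991 Thm 8.3 (one body, m → 0, OU),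
KusuokaLiang2010 (finitely many bodies,
gas-mediated coupling), ChernovLebowitzSinai2002 (one macroscopic piston, deterministic averaged
equations), OllaVaradhanYau1993 +
LiveraniOlla1996 (noise by  [refs: 2310.13338, 2605.19694, Spohn1991, KusuokaLiang2010, CanestrariLiveraniOlla2026, DurrGoldsteinLebowitz1981, ChernovLebowitzSinai2002, OllaVaradhanYau1993, LiveraniOlla1996]

Barriers (technique_class: hamiltonian-bath-noise, vanishing-solvent, relative-entropy): - technique_class: hamiltonian-bath-noise, vanishing-solvent, relative-entropy
- Literature.Barriers.AtomisticToContinuum.BoltzmannHypothesisBarrier: X_E evades it the way OVY do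
(velocity noise supplies the ergodic theorem) but with the noise DERIVED — valid iff BathReduction
holds uniformly in N; for the conjunct (X_R) it is NOT evaded: it is converted into the
solvent-removal stability statement, honestly ranked as conjunct-complete.
- Literature.Barriers.AtomisticToContinuum.HighMomentumCutoffBarrier: not evaded by fiat: OVY needed
a modified kinetic energy even with noise; the bet is that Epstein friction at rate γ_N → ∞ gives
the Povzner-type exponential-moment control inside the entropy method (layer 2 of X_E, shared with
RelEntropyErgodic 0781).
- Literature.Barriers.AtomisticToContinuum.HighMomentumCutoffBarrierNarrow: it applies squarely to
layer 2 of X_E (Yau/OVY entropy-inequality control with Maxwellian references, true kinetic energy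
|p|²/2 and the convective energy current p|p|²/2): it does not evade it; the bet is the NEW a-priori
input the barrier asks for — Epstein friction of the light bath at rate γ_N → ∞ per macroscopic
time, giving exponential velocity-moment bounds along the bathed dynamics (to be proved; shared with
RelEntropyErgodic 0781) — while X_R and the assembly never touch the entropy inequality.
- Literature.Barriers.AtomisticToContinuum.NoBVEstimatesMultiDBarrier: not met — every statement is
pre-shock (t < T, classical Euler reference on 𝕋³);

History (route lifecycle, newest last):
- 2026-08-15T13:41:57Z · CLOSED retired — not-a-thesis: assembly does not conclude the sub-problem Statement (operator:999:1257524)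

sub-problem: HydrodynamicLimit · status: closed(retired) · opened planner-plancard-AtomisticToContinuum-Hydrody-21be8e3f-0 2026-08-15T11:44:38Z · rev 0 · ledger route-AtomisticToContinuum-EinsteinBath
GENERATED by the gate from the ledger (D-0016/17). Provers cite these decls: `theorem foo : Summit.AtomisticToContinuum.HydrodynamicLimit.Theses.EinsteinBath.<Decl> := …` in Summits/AtomisticToContinuum/HydrodynamicLimit/Theorems/<Name>.lean.
-/

namespace Summit.AtomisticToContinuum.HydrodynamicLimit.Theses.EinsteinBath

open scoped BigOperators Topology Manifold Classical MeasureTheory ProbabilityTheory Matrix InnerProductSpace ComplexConjugate ContinuousMap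
open Filter Set Function TopologicalSpace MeasureTheory

attribute [summit_statement] _root_.HydrodynamicLimit

/-- item stmt-AtomisticToContinuum-6110 · crux · rank 2 · closed · moot by None · by planner
why it might fail: OVY kept noise θ(ε)→∞ yet still had to modify the kinetic energy (cubic velocity term, arkeryd1993 p.116): bath friction need not cure it; and BathReduction uniform in N (shadowing between spheres at distance O(ε)) is unproved.
sources: OllaVaradhanYau1993, lit:arkeryd1993 p.116-117, DurrGoldsteinLebowitz1981, KusuokaLiang2010, LiveraniOlla1996, FritzFunakiLebowitz1994
[crux] (card cruxes 1+2, rung R1 in the OVY window) for all 0 < a < 1/3, 0 < b < 2/3 − 2a, all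
continuous profiles a₀, θ₀ > 0, u₀: ∃ σ₀ ∀ σ ∈ (0,σ₀) ∀ classical hs-Euler solutions on [0,T) ∀
hard-sphere flows Φ_N ∀ two-species flows Ψ_N (N+1 spheres of diameter hsDiameter σ N, K_N =
⌊(N+1)^(1−a)⌋ points of mass (N+1)^(−b); Ψ_N measurable, Lebesgue-preserving on the mixed hard-body
domain, a.e. orbit a mixed hard-body trajectory: free flight, elastic sphere–sphere collisions,
mass-(1,m) specular sphere–point collisions; all such Ψ agree a.e.): if the local Gibbs fields
converge at t = 0, then for every t < T the empirical density/momentum/energy fields of the SPHERE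
component of Ψ_N(t) converge in probability, under the joint law localGibbs ⊗ (K_N i.i.d. lights
uniform outside the exclusion balls × Maxwellian of mass m_N at θ₀(x), drift u₀(x)), to (ρ, ρu,
E)(t). Layer-2 content: BathReduction (rank 3, informal) + OVY's theorem for hard spheres driven by
the bath's exchange kernel. [deps: MixedFlowExists, BathMarginalExact] [difficulty: open-problem] -/
@[route_item "route-AtomisticToContinuum-EinsteinBath"]
def EinsteinBathEuler : Prop :=
  let TT := Literature.MathematicalPhysics.KineticTheory.T3; let VV := Literature.MathematicalPhysics.KineticTheory.V3; let CFG : ℕ → Type := fun n => Literature.Analysis.FluidPDE.Config n (Fin 3) TT; let G : Literature.Analysis.FluidPDE.Geometry (Fin 3) TT := Literature.Analysis.FluidPDE.Torus.geometry (Fin 3); let D : TT → TT → ℝ := fun x y => ‖G.sepVec x y‖; let IsMF : (n k : ℕ) → ℝ → ℝ → (ℝ → CFG n × CFG k → CFG n × CFG k) → Prop := fun n k ε m Ψ => (let dom : Set (CFG n × CFG k) := {x | x.1 ∈ Literature.Analysis.FluidPDE.hardSphereDomain G n ε ∧ ∀ j i, ε / 2 ≤ D (x.2 j).1 (x.1 i).1};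 let μ : MeasureTheory.Measure (CFG n × CFG k) := MeasureTheory.volume.restrict dom; let hit : Fin n → Fin k → CFG n × CFG k → CFG n × CFG k := fun i j x => (let nv := G.sepVec (x.2 j).1 (x.1 i).1; let c := inner ℝ nv ((x.2 j).2 - (x.1 i).2) / ‖nv‖ ^ 2; (Function.update x.1 i ((x.1 i).1, (x.1 i).2 + (2 * m / (1 + m) * c) • nv), Function.update x.2 j ((x.2 j).1, (x.2 j).2 - (2 / (1 + m) * c) • nv))); let traj : (ℝ → CFG n × CFG k) → Prop := fun p => (let CT : Set ℝ := {t | (∃ i i', i ≠ i' ∧ D ((p t).1 i).1 ((p t).1 i').1 = ε) ∨ (∃ j i, D ((p t).2 j).1 ((p t).1 i).1 = ε / 2)}; (∀ t, p t ∈ dom) ∧ (∀ t₁ t₂, (CT ∩ Set.Icc t₁ t₂).Finite) ∧ (Continuous fun t => (fun i => ((p t).1 i).1, fun j => ((p t).2 j).1)) ∧ (∀ s t, s ≤ t → (∀ τ ∈ Set.Ioc s t, τ ∉ CT) → p t = (Literature.Analysis.FluidPDE.freeFlight G (t - s) (p s).1, Literature.Analysis.FluidPDE.freeFlight G (t - s)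 (p s).2)) ∧ (∀ t ∈ CT, ∃ xl, Filter.Tendsto p (nhdsWithin t (Set.Iio t)) (nhds xl) ∧ ((∃ i i', i ≠ i' ∧ D (xl.1 i).1 (xl.1 i').1 = ε ∧ Literature.Analysis.FluidPDE.IsIncoming G xl.1 i i' ∧ p t = (Literature.Analysis.FluidPDE.collidePair G i i' xl.1, xl.2)) ∨ (∃ j i, D (xl.2 j).1 (xl.1 i).1 = ε / 2 ∧ inner ℝ (G.sepVec (xl.2 j).1 (xl.1 i).1) ((xl.2 j).2 - (xl.1 i).2) < 0 ∧ p t = hit i j xl)))); (∀ t, Measurable (Ψ t)) ∧ (∀ t, MeasureTheory.MeasurePreserving (Ψ t) μ μ) ∧ (Filter.Eventually (fun x => Ψ 0 x = x ∧ traj (fun t => Ψ t x)) (MeasureTheory.ae μ))); ∀ (a b : ℝ), 0 < a → a < 1 / 3 → 0 < b → b < 2 / 3 - 2 * a → ∀ (a₀ θ₀ : TT → ℝ) (u₀ : TT → VV), Continuous a₀ → Continuous θ₀ → Continuous u₀ → (∀ x, 0 < a₀ x) → (∀ x, 0 < θ₀ x) → ∃ σ₀ : ℝ, 0 < σ₀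 ∧ ∀ σ : ℝ, 0 < σ → σ < σ₀ → let ε : ℕ → ℝ := fun N => Literature.MathematicalPhysics.KineticTheory.hsDiameter σ N; ∀ (T : ℝ) (ρ θ : ℝ → TT → ℝ) (u : ℝ → TT → VV), Literature.MathematicalPhysics.KineticTheory.IsHardSphereEulerSolution σ T ρ u θ → ∀ Φ : (N : ℕ) → Literature.Analysis.FluidPDE.HardSphereFlow G (ε N) (N + 1), let K : ℕ → ℕ := fun N => ⌊(N + 1 : ℝ) ^ (1 - a)⌋₊; let m : ℕ → ℝ := fun N => (N + 1 : ℝ) ^ (-b); let Tz : (ℕ → ENNReal) → Prop := fun f => Filter.Tendsto f Filter.atTop (nhds 0); let LG : (N : ℕ) → MeasureTheory.Measure (CFG (N + 1)) := fun N => Literature.MathematicalPhysics.KineticTheory.localGibbsLaw σ a₀ u₀ θ₀ N (Φ N); let P : (N : ℕ) → MeasureTheory.Measure (CFG (N + 1) × CFG (K N)) := fun N => ((LG N).prod MeasureTheory.volume).withDensity (fun x => ENNReal.ofReal (∏ j, (1 - Real.pi * σ ^ 3 / 6)⁻¹ * (if ∀ i, ε N / 2 < D (x.2 j).1 (x.1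 i).1 then (1 : ℝ) else 0) * Literature.Analysis.FluidPDE.localMaxwellian 1 (θ₀ (x.2 j).1 / m N) (u₀ (x.2 j).1) (x.2 j).2)); ∀ Ψ : (N : ℕ) → ℝ → CFG (N + 1) × CFG (K N) → CFG (N + 1) × CFG (K N), (∀ N, IsMF (N + 1) (K N) (ε N) (m N) (Ψ N)) → Literature.MathematicalPhysics.KineticTheory.TendstoHydroFieldsAt LG Φ ρ u θ 0 → ∀ t ∈ Set.Ico 0 T, (∀ χ : TT → ℝ, Continuous χ → ∀ δ : ℝ, 0 < δ → Tz (fun N => P N {x | δ < |Literature.MathematicalPhysics.KineticTheory.empiricalDensityField (Ψ N t x).1 χ - ∫ y, χ y * ρ t y|}) ∧ Tz (fun N => P N {x | δ < ‖Literature.MathematicalPhysics.KineticTheory.empiricalMomentumField (Ψ N t x).1 χ - ∫ y, (χ y * ρ t y) • u t y‖}) ∧ Tz (fun N => P N {x | δ < |Literature.MathematicalPhysics.KineticTheory.empiricalEnergyField (Ψ N t x).1 χ - ∫ y, χ y * Literature.MathematicalPhysics.KineticTheory.totalEnergyDensity (ρ t y) (u t y) (θ t y)|}))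

/-- item stmt-AtomisticToContinuum-6111 · crux · rank 4 · closed · moot by None · by planner
why it might fail: given EinsteinBathEuler it is equivalent to the conjunct: Lyapunov rate ≍ N^(1/3) defeats any pathwise coupling, and no law-level stability of macroscopic fields under o(1)-per-collision perturbations is known (same status as VanishingNoise 0812).
sources: OllaVaradhanYau1993, Spohn1991, lit:arkeryd1993 p.117, KusuokaLiang2010
[crux] (card crux 3, rungs R2–R3: removal of a vanishing solvent) for all (a,b) in the window, σ ∈
(0,1), continuous profiles, hard-sphere flows Φ_N, two-species flows Ψ_N as above, all target fields
(ρ,u,θ)(t,·) and times t: if the sphere fields of Ψ_N(t) converge in probability under the joint law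
to (∫χρ_t, ∫χρ_t u_t, ∫χE_t) for all continuous χ, then TendstoHydroFieldsAt (localGibbsLaw) Φ ρ u θ
t — the bare deterministic hard-sphere fields converge to the same targets. Physically: a solvent
with energy/momentum/pressure content O(N^(−a)), transport O(N^(−2a)) and per-collision
randomisation O(N^(−a−b/2)) does not change the Euler-scale fields of the solute. [deps:
EinsteinBathEuler] [difficulty: open-problem] -/
@[route_item "route-AtomisticToContinuum-EinsteinBath"]
def BathRemoval : Prop :=
  let TT := Literature.MathematicalPhysics.KineticTheory.T3; let VV := Literature.MathematicalPhysics.KineticTheory.V3; let CFG : ℕ → Type := fun n => Literature.Analysis.FluidPDE.Config n (Fin 3) TT; let G : Literature.Analysis.FluidPDE.Geometry (Fin 3) TT := Literature.Analysis.FluidPDE.Torus.geometry (Fin 3); let D : TT → TT → ℝ := fun x y => ‖G.sepVec x y‖; let IsMF : (n k : ℕ) → ℝ → ℝ → (ℝ → CFG n × CFG k → CFG n × CFG k) → Prop := fun n k ε m Ψ => (let dom : Set (CFG n × CFG k) := {x | x.1 ∈ Literature.Analysis.FluidPDE.hardSphereDomain G n ε ∧ ∀ j i, ε / 2 ≤ D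 (x.2 j).1 (x.1 i).1}; let μ : MeasureTheory.Measure (CFG n × CFG k) := MeasureTheory.volume.restrict dom; let hit : Fin n → Fin k → CFG n × CFG k → CFG n × CFG k := fun i j x => (let nv := G.sepVec (x.2 j).1 (x.1 i).1; let c := inner ℝ nv ((x.2 j).2 - (x.1 i).2) / ‖nv‖ ^ 2; (Function.update x.1 i ((x.1 i).1, (x.1 i).2 + (2 * m / (1 + m) * c) • nv), Function.update x.2 j ((x.2 j).1, (x.2 j).2 - (2 / (1 + m) * c) • nv))); let traj : (ℝ → CFG n × CFG k) → Prop := fun p => (let CT : Set ℝ := {t | (∃ i i', i ≠ i' ∧ D ((p t).1 i).1 ((p t).1 i').1 = ε) ∨ (∃ j i, D ((p t).2 j).1 ((p t).1 i).1 = ε / 2)}; (∀ t, p t ∈ dom) ∧ (∀ t₁ t₂, (CT ∩ Set.Icc t₁ t₂).Finite) ∧ (Continuous fun t => (fun i => ((p t).1 i).1, fun j => ((p t).2 j).1)) ∧ (∀ s t, s ≤ t → (∀ τ ∈ Set.Ioc s t, τ ∉ CT) → p t = (Literature.Analysis.FluidPDE.freeFlight G (t - s) (p s).1, Literature.Analysis.FluidPDE.freeFlight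 G (t - s) (p s).2)) ∧ (∀ t ∈ CT, ∃ xl, Filter.Tendsto p (nhdsWithin t (Set.Iio t)) (nhds xl) ∧ ((∃ i i', i ≠ i' ∧ D (xl.1 i).1 (xl.1 i').1 = ε ∧ Literature.Analysis.FluidPDE.IsIncoming G xl.1 i i' ∧ p t = (Literature.Analysis.FluidPDE.collidePair G i i' xl.1, xl.2)) ∨ (∃ j i, D (xl.2 j).1 (xl.1 i).1 = ε / 2 ∧ inner ℝ (G.sepVec (xl.2 j).1 (xl.1 i).1) ((xl.2 j).2 - (xl.1 i).2) < 0 ∧ p t = hit i j xl)))); (∀ t, Measurable (Ψ t)) ∧ (∀ t, MeasureTheory.MeasurePreserving (Ψ t) μ μ) ∧ (Filter.Eventually (fun x => Ψ 0 x = x ∧ traj (fun t => Ψ t x)) (MeasureTheory.ae μ))); ∀ (a b : ℝ), 0 < a → a < 1 / 3 → 0 < b → b < 2 / 3 - 2 * a → ∀ σ : ℝ, 0 < σ → σ < 1 → let ε : ℕ → ℝ := fun N => Literature.MathematicalPhysics.KineticTheory.hsDiameter σ N; ∀ (a₀ θ₀ : TT → ℝ) (u₀ : TT → VV), Continuous a₀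 → Continuous θ₀ → Continuous u₀ → (∀ x, 0 < a₀ x) → (∀ x, 0 < θ₀ x) → ∀ Φ : (N : ℕ) → Literature.Analysis.FluidPDE.HardSphereFlow G (ε N) (N + 1), let K : ℕ → ℕ := fun N => ⌊(N + 1 : ℝ) ^ (1 - a)⌋₊; let m : ℕ → ℝ := fun N => (N + 1 : ℝ) ^ (-b); let Tz : (ℕ → ENNReal) → Prop := fun f => Filter.Tendsto f Filter.atTop (nhds 0); let LG : (N : ℕ) → MeasureTheory.Measure (CFG (N + 1)) := fun N => Literature.MathematicalPhysics.KineticTheory.localGibbsLaw σ a₀ u₀ θ₀ N (Φ N); let P : (N : ℕ) → MeasureTheory.Measure (CFG (N + 1) × CFG (K N)) := fun N => ((LG N).prod MeasureTheory.volume).withDensity (fun x => ENNReal.ofReal (∏ j, (1 - Real.pi * σ ^ 3 / 6)⁻¹ * (if ∀ i, ε N / 2 < D (x.2 j).1 (x.1 i).1 then (1 : ℝ) else 0) * Literature.Analysis.FluidPDE.localMaxwellian 1 (θ₀ (x.2 j).1 / m N) (u₀ (x.2 j).1) (x.2 j).2)); ∀ Ψ : (N : ℕ) → ℝ → CFG (N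 + 1) × CFG (K N) → CFG (N + 1) × CFG (K N), (∀ N, IsMF (N + 1) (K N) (ε N) (m N) (Ψ N)) → ∀ (ρ θ : ℝ → TT → ℝ) (u : ℝ → TT → VV) (t : ℝ), (∀ χ : TT → ℝ, Continuous χ → ∀ δ : ℝ, 0 < δ → Tz (fun N => P N {x | δ < |Literature.MathematicalPhysics.KineticTheory.empiricalDensityField (Ψ N t x).1 χ - ∫ y, χ y * ρ t y|}) ∧ Tz (fun N => P N {x | δ < ‖Literature.MathematicalPhysics.KineticTheory.empiricalMomentumField (Ψ N t x).1 χ - ∫ y, (χ y * ρ t y) • u t y‖}) ∧ Tz (fun N => P N {x | δ < |Literature.MathematicalPhysics.KineticTheory.empiricalEnergyField (Ψ N t x).1 χ - ∫ y, χ y * Literature.MathematicalPhysics.KineticTheory.totalEnergyDensity (ρ t y) (u t y) (θ t y)|})) → Literature.MathematicalPhysics.KineticTheory.TendstoHydroFieldsAt LG Φ ρ u θ t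

-- item stmt-AtomisticToContinuum-7125 · support · rank 3 · closed · moot by None · by planner — informal only, no Lean statement yet:
--   [crux] BATH REDUCTION UNIFORM IN N (card crux 1; layer-2 child-to-be of EinsteinBathEuler). In the
--   window 0<a<1/3, 0<b<2/3-2a, for local Gibbs sphere data x the conditioned ideal light bath of
--   EinsteinBathEuler (K_N = floor((N+1)^(1-a)) points of mass m_N = (N+1)^(-b), uniform outside the
--   spheres, Maxwellian at theta0(x), drift u0(x)) and t < T: expectations of smooth cylinder statistics
--   of the SPHERE fields under the two-species flow Psi_N are within o(1) (uniformly on [0,T]) of those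
--   under the reduced dynamics S_N(gamma_N) = hard-sphere flow + conservative Ornstein-Uhlenbeck
--   momentum/energy

/-- item stmt-AtomisticToContinuum-6112 · support · rank 9 · closed · moot by None · by planner
sources: Alexander1975 (via Literature HardSphereDynamics.lean), GallagherSaintRaymondTexier2013 Prop. 4.1.1, Spohn1991 Thm 8.3
[support] CONSTRUCTION item for the posited object (never smuggled into the cruxes): for all n, k, 0
< ε < 1/2, m > 0 there is a two-species hard-body flow Ψ on 𝕋³ (n spheres of diameter ε and mass 1,
k points of mass m; measurable, Lebesgue-preserving on the mixed domain, identity at time 0 a.e.,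
a.e. orbit a mixed trajectory; the group law follows from a.e. uniqueness) — Alexander's theorem for
a binary hard-ball mixture with radii (ε/2, 0) (locally finitely many collisions a.e. by energy
bounds; points never meet). [difficulty: L] -/
@[route_item "route-AtomisticToContinuum-EinsteinBath"]
def MixedFlowExists : Prop :=
  let TT := Literature.MathematicalPhysics.KineticTheory.T3; let CFG : ℕ → Type := fun n => Literature.Analysis.FluidPDE.Config n (Fin 3) TT; let G : Literature.Analysis.FluidPDE.Geometry (Fin 3) TT := Literature.Analysis.FluidPDE.Torus.geometry (Fin 3); let D : TT → TT → ℝ := fun x y => ‖G.sepVec x y‖; let IsMF : (n k : ℕ) → ℝ → ℝ → (ℝ → CFG n × CFG k → CFG n × CFG k) → Prop := fun n k ε m Ψ => (let dom : Set (CFG n × CFG k) := {x | x.1 ∈ Literature.Analysis.FluidPDE.hardSphereDomain G n ε ∧ ∀ j i, ε / 2 ≤ D (x.2 j).1 (x.1 i).1}; let μ : MeasureTheory.Measure (CFG n × CFG k) := MeasureTheory.volume.restrict dom; let hit : Fin n → Fin k → CFG n × CFG k → CFG n × CFG k := fun i j x => (let nv := G.sepVec (x.2 j).1 (x.1 i).1;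 let c := inner ℝ nv ((x.2 j).2 - (x.1 i).2) / ‖nv‖ ^ 2; (Function.update x.1 i ((x.1 i).1, (x.1 i).2 + (2 * m / (1 + m) * c) • nv), Function.update x.2 j ((x.2 j).1, (x.2 j).2 - (2 / (1 + m) * c) • nv))); let traj : (ℝ → CFG n × CFG k) → Prop := fun p => (let CT : Set ℝ := {t | (∃ i i', i ≠ i' ∧ D ((p t).1 i).1 ((p t).1 i').1 = ε) ∨ (∃ j i, D ((p t).2 j).1 ((p t).1 i).1 = ε / 2)}; (∀ t, p t ∈ dom) ∧ (∀ t₁ t₂, (CT ∩ Set.Icc t₁ t₂).Finite) ∧ (Continuous fun t => (fun i => ((p t).1 i).1, fun j => ((p t).2 j).1)) ∧ (∀ s t, s ≤ t → (∀ τ ∈ Set.Ioc s t, τ ∉ CT) → p t = (Literature.Analysis.FluidPDE.freeFlight G (t - s) (p s).1, Literature.Analysis.FluidPDE.freeFlight G (t - s) (p s).2)) ∧ (∀ t ∈ CT, ∃ xl, Filter.Tendsto p (nhdsWithin t (Set.Iio t)) (nhds xl) ∧ ((∃ i i', i ≠ i' ∧ D (xl.1 i).1 (xl.1 i').1 = ε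 ∧ Literature.Analysis.FluidPDE.IsIncoming G xl.1 i i' ∧ p t = (Literature.Analysis.FluidPDE.collidePair G i i' xl.1, xl.2)) ∨ (∃ j i, D (xl.2 j).1 (xl.1 i).1 = ε / 2 ∧ inner ℝ (G.sepVec (xl.2 j).1 (xl.1 i).1) ((xl.2 j).2 - (xl.1 i).2) < 0 ∧ p t = hit i j xl)))); (∀ t, Measurable (Ψ t)) ∧ (∀ t, MeasureTheory.MeasurePreserving (Ψ t) μ μ) ∧ (Filter.Eventually (fun x => Ψ 0 x = x ∧ traj (fun t => Ψ t x)) (MeasureTheory.ae μ))); ∀ (n k : ℕ) (ε m : ℝ), 0 < ε → ε < 1 / 2 → 0 < m → ∃ Ψ : ℝ → CFG n × CFG k → CFG n × CFG k, IsMF n k ε m Ψ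

/-- item stmt-AtomisticToContinuum-6113 · support · rank 9 · closed · moot by None · by planner
sources: Spohn1991 Part I Ch. 3, Literature HardSphereEuler.lean (succ_mul_hsDiameter_pow_three)
[support] the bath is statically invisible: for σ ∈ (0,1), continuous profiles (a₀, θ₀ > 0, u₀),
every N, k, m > 0 and flow Φ, the sphere marginal (push-forward under Prod.fst) of the joint law
localGibbsLaw ⊗ [k i.i.d. lights with density (1 − πσ³/6)⁻¹·𝟙(outside all balls B(q_i,
ε/2))·Maxwellian_m(θ₀(x), u₀(x))] IS localGibbsLaw σ a₀ u₀ θ₀ N Φ — the exclusion balls of radius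
ε/2 around centres at mutual distance ≥ ε are disjoint, so the excluded volume (N+1)(π/6)ε³ = πσ³/6
is configuration-independent (no depletion interaction). [difficulty: provable-now] -/
@[route_item "route-AtomisticToContinuum-EinsteinBath"]
def BathMarginalExact : Prop :=
  let TT := Literature.MathematicalPhysics.KineticTheory.T3; let VV := Literature.MathematicalPhysics.KineticTheory.V3; let CFG : ℕ → Type := fun n => Literature.Analysis.FluidPDE.Config n (Fin 3) TT; let G : Literature.Analysis.FluidPDE.Geometry (Fin 3) TT := Literature.Analysis.FluidPDE.Torus.geometry (Fin 3); let D : TT → TT → ℝ := fun x y => ‖G.sepVec x y‖; ∀ σ : ℝ, 0 < σ → σ < 1 → ∀ (a₀ θ₀ : TT → ℝ) (u₀ : TT → VV), Continuous a₀ → Continuous θ₀ → Continuous u₀ → (∀ x, 0 < a₀ x) → (∀ x, 0 < θ₀ x) → ∀ (N k : ℕ) (m : ℝ), 0 < m → ∀ Φ : Literature.Analysis.FluidPDE.HardSphereFlow (Literature.Analysis.FluidPDE.Torus.geometry (Fin 3)) (Literature.MathematicalPhysics.KineticTheory.hsDiameter σ N) (N + 1), let P : MeasureTheory.Measure (CFG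 (N + 1) × CFG k) := ((Literature.MathematicalPhysics.KineticTheory.localGibbsLaw σ a₀ u₀ θ₀ N Φ).prod MeasureTheory.volume).withDensity (fun x => ENNReal.ofReal (∏ j, (1 - Real.pi * σ ^ 3 / 6)⁻¹ * (if ∀ i, Literature.MathematicalPhysics.KineticTheory.hsDiameter σ N / 2 < D (x.2 j).1 (x.1 i).1 then (1 : ℝ) else 0) * Literature.Analysis.FluidPDE.localMaxwellian 1 (θ₀ (x.2 j).1 / m) (u₀ (x.2 j).1) (x.2 j).2)); P.map Prod.fst = Literature.MathematicalPhysics.KineticTheory.localGibbsLaw σ a₀ u₀ θ₀ N Φ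

/-- item stmt-AtomisticToContinuum-6114 · assembly · rank 1 · closed · moot by None · by planner
sources: Spohn1991, OllaVaradhanYau1993
[assembly] MixedFlowExists → EinsteinBathEuler → BathRemoval → HydrodynamicLimit. -/
@[route_item "route-AtomisticToContinuum-EinsteinBath"]
def Assembly : Prop :=
  MixedFlowExists → EinsteinBathEuler → BathRemoval → Literature.MathematicalPhysics.KineticTheory.HydrodynamicLimit

end Summit.AtomisticToContinuum.HydrodynamicLimit.Theses.EinsteinBath
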